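import Literature.MathematicalPhysics.QuantumFieldTheory.Balaban1983to89.B1Cor23DictZeroFieldTorus

/-!
# `Balaban1983to89.B1Cor23DerivZeroFieldTorus` — T. Bałaban, *(Higgs)₂,₃ quantum fields in a finite volume. I. A lower bound*, Commun. Math.
# Phys. **85** (1982) 603–626 [Balaban1982Higgs1] with *Regularity and decay of lattice Green's functions*, Commun. Math. Phys. **89** (1983)
# 571–597 [Balaban1983RegularityDecay]: ALL FOUR `L²` PAIRINGS OF [B4] COROLLARY 2.3 (2.30) — `⟨g, G^ε_kg′⟩`, `⟨h, D^ε_0G^ε_kg′⟩`,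
# `⟨g, G^ε_kD^{ε*}_0h′⟩`, `⟨h, D^ε_0G^ε_kD^{ε*}_0h′⟩` — PROVED FOR THE (Higgs)₂,₃ MODEL'S PROPAGATOR `G^ε_k(T_ε, 0)` (2.20) AT ZERO FIELD on
# the torus sub-family `M·L′_μ = L^m`, every level `1 ≦ k ≦ K`, every coupling, every `N`, with NO mass cap

statement-level skeleton of published theorems with citation tags; proofs where landed; nothing here is a claim about the Yang–Mills mass gap

PDF held: `paper:balaban1982-cmp85-higgs23-i` (journal page = PDF page + 602), p. 604 [PDF 2] ((1.3)–(1.5)), p. 605 [PDF 3] ((1.7)–(1.8),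
(1.11)), p. 610 [PDF 8] ((2.20), (2.22), (2.25)); `paper:balaban1983-cmp89-regularity-decay`, p. 580 [PDF 10] (Cor. 2.3 (2.30)), p. 581
[PDF 11]; materialised and read by this seat (gen 9/10).

CITATION HEADER (lean-in-tree rule).  Cell `lit-balaban` (HOME `run/shared/lean/pub/lit-balaban/`), Phase-2 proof seat **p14** gen 10 (unit
`lit-balaban-p14`), file 4 of the gen; SKELETON rows **B4.Cor2.3** ((2.30) MODEL INSTANCE on the (Higgs)₂,₃ carrier at `A = 0`, owner r01) and
**B1.Prop2.1** ((2.25)-type `L²` decay of `G^ε_k(T_ε,0)` and its covariant derivatives, owner r14).  The sequel of gen 9's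
`B1Cor23ZeroFieldTorus.propagatorK_pairing_bound` (FIRST pairing only, by Schur's test, under a mass cap `L^kε ≦ ε₀`): here all four pairings
come from the TORUS Combes–Thomas theorem `B4Cor23ZeroTorus.pairing_G/DG/GDt/DGDt` (this seat, files 1–2 of the gen) transported through gen 8/9's
ONE-LATTICE-TWO-FORMALIZATIONS dictionaries.  USED BY NAME, never restated: `B1Eq211ZeroFieldTorusLevels.{setupAt, eSiteAt, cmpAt, cmpAt_apply,
eSiteAt_symm_unshift, mesh_zero_eq_at, spacing_top, le_range_at}`, `B1Eq220ZeroFieldTorusLevels.{cmpAt_propagatorK, T_eq_tdist_symm}`,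
`B1Ineq225DerivZeroFieldTorus.sderiv_propagatorK_apply_at`, `B1Cor23ZeroFieldTorus.{siteInner_eq_sum_dot, sum_sq_cmpAt_eq}`,
`B1Eq211ZeroFieldTorus.transpose_deriv_mulVec`, `B5Display136Torus.G_eq_smul_Grs`, `HiggsCovariancePos.{sum_site_dir, shiftEquiv}`, the typer's
`HiggsLattice.{siteInner, bondInner, covDeriv, sderiv, covDeriv_zero, Site.tdist}`, `HiggsCovariance.propagatorK`.

WHAT IS PRINTED (verbatim).  B4 p. 580 [PDF 10]: *"Corollary 2.3. If Ω and A are as in Proposition I.2.1, then there exist positive constants c₀,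
δ₀ such that for arbitrary scalar field configurations f, f′ defined on Ω, we have |⟨f, G_k(Ω,A)f′⟩|, |⟨f, D^η_{A,μ}G_k(Ω,A)f′⟩|,
|⟨f, G_k(Ω,A)D^{η*}_{A,ν}f′⟩|, |⟨f, D^η_{A,μ}G_k(Ω,A)D^{η*}_{A,ν}f′⟩| ≦ c₀e^{−δ₀dist(supp f, supp f′)}‖f‖₂‖f′‖₂. (2.30)"*; p. 581: *"Let us notice
also that now there are no restrictions on supports of f, f′"*.  B1 p. 604 [PDF 2]: *"⟨f, g⟩ = Σ_x ε^d f(x)·g(x) (1.5)"* for functions *"defined on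
the points of the lattice … or on the bonds of this lattice"* (p. 607); p. 605 [PDF 3]: *"(D^ε_Aφ)(b) = ε^{−1}(U(A_b)φ(b₊) − φ(b₋)) (1.7)"*,
*"⟨φ, (−Δ^ε_A)φ⟩ = Σ_b ε^d|(D^ε_Aφ)(b)|² (1.8)"* with *"−Δ^ε = ∂^{ε*}∂^ε"* (after (1.11)); p. 610 [PDF 8]: *"G^ε_k(Ω, A) = (−Δ^{ε,N}_{A,Ω} + m² +
a_k(L^kε)^{−2}P_k(A))^{−1} (2.20)"*, *"the rescaled propagator is given by G_k(Ω, A) = (−Δ^{η,N}_{A,Ω} + m²(L^kε)² + a_kP_k(A))^{−1} (2.22)"*.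

DICTIONARY.  `G^ε_k(T_ε,0) = propagatorK C univ 0 m² a k` (the typer's; at `A = 0` every coupling `C` gives the same operator); `D^ε_0 = covDeriv C 0
= sderiv` (`covDeriv_zero`); the ADJOINT `D^{ε*}_0` of `D^ε_0` for the scalar products (1.5) on sites and bonds (same weight `ε^d`) is the explicit
site field `(D^{ε*}_0h)(x) = ε^{−1}Σ_ν (h(⟨x − εe_ν, x⟩) − h(⟨x, x + εe_ν⟩))` — written out as a lambda in the statements and CERTIFIED by
`siteInner_adjDeriv` (`⟨φ, D^{ε*}_0h⟩ = ⟨D^ε_0φ, h⟩` for all `φ`); bond test functions `h : bonds → ℝ^N` (all directions at once: the printed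
`D^η_{A,μ}` with `μ` fixed is the case of `h` supported on `μ`-bonds); `dist(supp h, supp g′) ↦` any `R` with `R ≦ |b₋ − x′|` ((1.3), lattice
units of `T_ε`) on the supports; the exponent `R/L^k = (L^kε)^{−1}·εR` is the printed `(L^kε)^{−1}dist` of (2.25); under `cmpAt` the model's
objects read on the level-`k` `Setup` torus `Q = setupAt S k` (`η = L^{−k}`, `ε = (L^kε)η`): `cmp_i(G^ε_kg) = (L^kε)²G_k^{resc}cmp_ig`,
`cmp_i((D^ε_0G^ε_kg)_μ) = (L^kε)(∂^η_μG_k^{resc})cmp_ig`, `cmp_i(D^{ε*}_0h) = (L^kε)^{−1}Σ_ν(∂^η_ν)ᵀcmp_ih_ν`.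

WHAT THIS FILE PROVES (kernel-checked, zero `sorry`, theorems only; axioms standard; file 2 of 2 of the model instance, on top of the dictionary
`B1Cor23DictZeroFieldTorus` and the torus theorem `B4Cor23ZeroTorus`).
* §1 **THE FOUR PAIRINGS (2.30) FOR THE MODEL AT `A = 0`, EXPLICIT, ONE TORUS**: for `1 ≦ k ≦ K`, `a > 0`, `m² ≧ 0`, every coupling, every `N`,
  an admissible `δ` (`0 ≦ δ`, `4δ ≦ 1`, `(2d + 4a)δ² ≦ γ′/4`, `γ′ = min{1, a(1 − L⁻²)}`) and supports `≧ R` apart: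
  `model_pairing_G` (`|⟨g, G^ε_kg′⟩| ≦ (4/γ′)(L^kε)²e^{−δR/L^k}‖g‖‖g′‖`), `model_pairing_DG` (`|⟨h, D^ε_0G^ε_kg′⟩| ≦ (12√d/γ′)(L^kε)e^{−δR/L^k}‖h‖‖g′‖`),
  `model_pairing_GDt` (`|⟨g, G^ε_kD^{ε*}_0h′⟩| ≦ (8√d/γ′)(L^kε)e^{−δR/L^k}‖g‖‖h′‖`), `model_pairing_DGDt` (`|⟨h, D^ε_0G^ε_kD^{ε*}_0h′⟩| ≦
  (24d/γ′)e^{−δR/L^k}‖h‖‖h′‖`) — norms `‖·‖ = ⟨·,·⟩^{1/2}` of (1.5); each = `B4Cor23ZeroTorus.pairing_*` componentwise on `setupAt S k` +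
  Cauchy–Schwarz over components / directions.
* §2 `exists_admissible_delta`; **`cor23_model_zeroField_torus`** — uniform packaging: for `L > 1`, `a > 0`, `d` there are `δ₀, c₀ > 0`
  (`δ₀ = min{¼, γ′/(8d+16a+4)}`, `c₀ = 24(d+1)/γ′`) such that all four hold on EVERY torus of the sub-family with `P.d = d`, `P.L = L`, every
  `N`, every coupling, every `m² ≧ 0`, every level `1 ≦ k ≦ K`, all test functions — with the powers `(L^kε)², (L^kε), (L^kε), 1` of (2.25)/(2.22).
HONEST SCOPE.  `A = 0`, `Ω = T_ε`, the sub-family `M·L′_μ = L^m` with `L` odd (the `Setup` tori; general Higgs tori would need per-direction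
periods); constants explicit but crude; the distance is the sup torus distance (1.3) in lattice units between bond INITIAL points / sites; nothing
about background fields `A ≠ 0` (the route needs gauge-covariant conjugation estimates not in the tree); nothing here is summit progress.
-/

open scoped BigOperators InnerProductSpace
open Matrix

namespace Literature.MathematicalPhysics.QuantumFieldTheory.Balaban1983to89.B1Cor23DerivZeroFieldTorus

open Literature.MathematicalPhysics.QuantumFieldTheory.Balaban1983to89.HiggsLattice (ChargeData siteInner bondInner covDeriv sderiv
  covDeriv_zero)
open Literature.MathematicalPhysics.QuantumFieldTheory.Balaban1983to89.HiggsCovariance (propagatorK)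
open Literature.MathematicalPhysics.QuantumFieldTheory.Balaban1983to89.HiggsCovariancePos (sum_site_dir shiftEquiv)
open Literature.MathematicalPhysics.QuantumFieldTheory.Balaban1983to89.B1RG242Torus (tower deriv)
open Literature.MathematicalPhysics.QuantumFieldTheory.Balaban1983to89.B5Display136Torus (Grs G_eq_smul_Grs)
open Literature.MathematicalPhysics.QuantumFieldTheory.Balaban1983to89.B5Ineq137Torus (T T_nonneg distX)
open Literature.MathematicalPhysics.QuantumFieldTheory.Balaban1983to89.B5CombesThomasTorus (nsq nsq_nonneg)
open Literature.MathematicalPhysics.QuantumFieldTheory.Balaban1983to89.B1Eq211ZeroFieldTorus (Shape transpose_deriv_mulVec)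
open Literature.MathematicalPhysics.QuantumFieldTheory.Balaban1983to89.B1Eq211ZeroFieldTorusLevels (setupAt setupAt_d setupAt_L
  eSiteAt cmpAt cmpAt_apply eSiteAt_symm_unshift mesh_zero_eq_at spacing_top le_range_at)
open Literature.MathematicalPhysics.QuantumFieldTheory.Balaban1983to89.B1Eq220ZeroFieldTorusLevels (cmpAt_propagatorK T_eq_tdist_symm)
open Literature.MathematicalPhysics.QuantumFieldTheory.Balaban1983to89.B1Ineq225DerivZeroFieldTorus (sderiv_propagatorK_apply_at)
open Literature.MathematicalPhysics.QuantumFieldTheory.Balaban1983to89.B1Cor23ZeroFieldTorus (siteInner_eq_sum_dot sum_sq_cmpAt_eq)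
open Literature.MathematicalPhysics.QuantumFieldTheory.Balaban1983to89.B4Cor23ZeroTorus (pairing_G pairing_DG pairing_GDt pairing_DGDt)

open Literature.MathematicalPhysics.QuantumFieldTheory.Balaban1983to89.B1Cor23DictZeroFieldTorus (G_top_eq_Grs bondInner_eq_sum_dot
  sum_sq_cmpAt_bond_eq cmpAt_covDeriv_propagatorK cmpAt_propagatorK_adjDeriv cmpAt_covDeriv_propagatorK_adjDeriv abs_sum_le_of_terms
  sqrt_scale sep_transport)

variable {P : HiggsLattice.Params}

/-! ## §1 The four pairings (2.30) for `G^ε_k(T_ε, 0)` — explicit constants, one torus -/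

section Pairings

variable {k N : ℕ} {msq a δ : ℝ}

/-- **(2.30), FIRST PAIRING, FOR THE MODEL AT `A = 0`** (no mass cap; cf. gen 9's `propagatorK_pairing_bound`): for `1 ≦ k ≦ K`, `a > 0`, `m² ≧ 0`,
an admissible `δ` and site fields `g, g′` with supports `≧ R` apart in (1.3): `|⟨g, G^ε_k(T_ε,0)g′⟩| ≦ (4/γ′)(L^kε)²e^{−δR/L^k}‖g‖‖g′‖`.
[cite: Balaban1983RegularityDecay, Cor. 2.3 (2.30) p.580; Balaban1982Higgs1, (2.20) p.610] -/
theorem model_pairing_G (S : Shape P) (hk : k ≤ P.K) (C : ChargeData N) (hk1 : 1 ≤ k) (ha : 0 < a) (hmsq : 0 ≤ msq) (hδ0 : 0 ≤ δ) (hδ4 : 4 * δ ≤ 1)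
    (hδγ : (2 * P.d + 4 * a) * δ ^ 2 ≤ min 1 (a * (1 - ((P.L : ℝ) ^ 2)⁻¹)) / 4) (R : ℝ) (g g' : HiggsLattice.ScalarField P 0 N)
    (hsep : ∀ x x', g x ≠ 0 → g' x' ≠ 0 → R ≤ (HiggsLattice.Site.tdist x x' : ℝ)) :
    |siteInner g (propagatorK C Finset.univ (0 : HiggsLattice.VecField P 0) msq a k g')|
      ≤ 4 / min 1 (a * (1 - ((P.L : ℝ) ^ 2)⁻¹)) * P.mesh k ^ 2 * Real.exp (-(δ * (R / (P.L : ℝ) ^ k))) *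
          Real.sqrt (siteInner g g) * Real.sqrt (siteInner g' g') := by
  set Q := setupAt S k with hQ
  set γ' := min 1 (a * (1 - ((P.L : ℝ) ^ 2)⁻¹)) with hγ'
  have hγ : 0 < γ' := B4Cor23ZeroTorusSolve.gammaPrime_pos (P := Q) ha
  have hm' : 0 ≤ msq * P.mesh k ^ 2 := mul_nonneg hmsq (sq_nonneg _)
  have hε : 0 < P.mesh 0 ^ P.d := pow_pos (P.mesh_pos 0) _
  have hkr : k ≤ Q.m + Q.K := le_range_at S k le_rfl
  -- termwise bound on the level-`k` torus
  have hterm : ∀ i : Fin N, |cmpAt S hk i g ⬝ᵥ (Grs Q a (msq * P.mesh k ^ 2) k *ᵥ cmpAt S hk i g')|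
      ≤ 4 / γ' * Real.exp (-(δ * (R / (P.L : ℝ) ^ k))) * Real.sqrt (nsq Q (cmpAt S hk i g)) * Real.sqrt (nsq Q (cmpAt S hk i g')) := by
    intro i
    exact pairing_G (P := Q) hk1 hkr ha hm' hδ0 hδ4 hδγ _ _ _
      (sep_transport S hk hsep _ _ (fun z hz h0 => hz (by rw [cmpAt_apply, h0]; rfl)) (fun z hz h0 => hz (by rw [cmpAt_apply, h0]; rfl)))
  have hsum := abs_sum_le_of_terms _ _ _ (by positivity) (fun i => nsq_nonneg _) (fun i => nsq_nonneg _) hterm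
  have hA : ∑ i : Fin N, nsq Q (cmpAt S hk i g) = (P.mesh 0 ^ P.d)⁻¹ * siteInner g g := sum_sq_cmpAt_eq S hk g
  have hB : ∑ i : Fin N, nsq Q (cmpAt S hk i g') = (P.mesh 0 ^ P.d)⁻¹ * siteInner g' g' := sum_sq_cmpAt_eq S hk g'
  rw [hA, hB, mul_assoc (4 / γ' * Real.exp (-(δ * (R / (P.L : ℝ) ^ k)))), sqrt_scale hε] at hsum
  -- the pairing through the components
  have hℓ : 0 < P.mesh k := P.mesh_pos k
  have hid : siteInner g (propagatorK C Finset.univ (0 : HiggsLattice.VecField P 0) msq a k g')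
      = P.mesh 0 ^ P.d * (P.mesh k ^ 2 * ∑ i : Fin N, (cmpAt S hk i g ⬝ᵥ (Grs Q a (msq * P.mesh k ^ 2) k *ᵥ cmpAt S hk i g'))) := by
    rw [siteInner_eq_sum_dot S hk]
    congr 1
    rw [Finset.mul_sum]
    refine Finset.sum_congr rfl fun i _ => ?_
    rw [cmpAt_propagatorK S hk C hk1 ha hmsq, G_top_eq_Grs S ha hm' hk1, dotProduct_smul, smul_eq_mul]
  rw [hid, abs_mul, abs_of_pos hε, abs_mul, abs_of_pos (pow_pos hℓ 2)]
  have hε' : P.mesh 0 ^ P.d * (P.mesh 0 ^ P.d)⁻¹ = 1 := mul_inv_cancel₀ hε.ne'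
  calc P.mesh 0 ^ P.d * (P.mesh k ^ 2 * |∑ i : Fin N, (cmpAt S hk i g ⬝ᵥ (Grs Q a (msq * P.mesh k ^ 2) k *ᵥ cmpAt S hk i g'))|)
      ≤ P.mesh 0 ^ P.d * (P.mesh k ^ 2 * (4 / γ' * Real.exp (-(δ * (R / (P.L : ℝ) ^ k))) *
          ((P.mesh 0 ^ P.d)⁻¹ * (Real.sqrt (siteInner g g) * Real.sqrt (siteInner g' g'))))) := by gcongr
    _ = (P.mesh 0 ^ P.d * (P.mesh 0 ^ P.d)⁻¹) * (4 / γ' * P.mesh k ^ 2 * Real.exp (-(δ * (R / (P.L : ℝ) ^ k))) *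
          Real.sqrt (siteInner g g) * Real.sqrt (siteInner g' g')) := by ring
    _ = _ := by rw [hε', one_mul]

/-- **(2.30), SECOND PAIRING `⟨h, D^ε_0G^ε_kg′⟩`, FOR THE MODEL AT `A = 0`**: same data, a bond field `h` and a site field `g′` whose
supports are `≧ R` apart (distance (1.3) from the initial point of the bond):
`|⟨h, D^ε_0G^ε_k(T_ε,0)g′⟩| ≦ (12√d/γ′)(L^kε)e^{−δR/L^k}‖h‖‖g′‖`. [cite: Balaban1983RegularityDecay, Cor. 2.3 (2.30) p.580; Balaban1982Higgs1, (1.7)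
p.605, (2.20) p.610] -/
theorem model_pairing_DG (S : Shape P) (hk : k ≤ P.K) (C : ChargeData N) (hk1 : 1 ≤ k) (ha : 0 < a) (hmsq : 0 ≤ msq) (hδ0 : 0 ≤ δ)
    (hδ4 : 4 * δ ≤ 1) (hδγ : (2 * P.d + 4 * a) * δ ^ 2 ≤ min 1 (a * (1 - ((P.L : ℝ) ^ 2)⁻¹)) / 4) (R : ℝ)
    (h : HiggsLattice.PBond P 0 → EuclideanSpace ℝ (Fin N)) (g' : HiggsLattice.ScalarField P 0 N)
    (hsep : ∀ b x', h b ≠ 0 → g' x' ≠ 0 → R ≤ (HiggsLattice.Site.tdist b.src x' : ℝ)) :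
    |bondInner h (covDeriv C (0 : HiggsLattice.VecField P 0) (propagatorK C Finset.univ (0 : HiggsLattice.VecField P 0) msq a k g'))|
      ≤ 12 / min 1 (a * (1 - ((P.L : ℝ) ^ 2)⁻¹)) * Real.sqrt P.d * P.mesh k * Real.exp (-(δ * (R / (P.L : ℝ) ^ k))) *
          Real.sqrt (bondInner h h) * Real.sqrt (siteInner g' g') := by
  set Q := setupAt S k with hQ
  set γ' := min 1 (a * (1 - ((P.L : ℝ) ^ 2)⁻¹)) with hγ'
  set E := Real.exp (-(δ * (R / (P.L : ℝ) ^ k))) with hE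
  have hγ : 0 < γ' := B4Cor23ZeroTorusSolve.gammaPrime_pos (P := Q) ha
  have hm' : 0 ≤ msq * P.mesh k ^ 2 := mul_nonneg hmsq (sq_nonneg _)
  have hε : 0 < P.mesh 0 ^ P.d := pow_pos (P.mesh_pos 0) _
  have hℓ : 0 < P.mesh k := P.mesh_pos k
  have hkr : k ≤ Q.m + Q.K := le_range_at S k le_rfl
  have hB0 : 0 ≤ 12 / γ' * E := by positivity
  -- termwise bound on the level-`k` torus
  have hterm : ∀ (μ : Fin P.d) (i : Fin N), |cmpAt S hk i (fun x => h ⟨x, μ⟩) ⬝ᵥ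
      ((deriv Q 0 ((P.L : ℝ) ^ k)⁻¹ μ * Grs Q a (msq * P.mesh k ^ 2) k) *ᵥ cmpAt S hk i g')|
        ≤ 12 / γ' * E * Real.sqrt (nsq Q (cmpAt S hk i (fun x => h ⟨x, μ⟩))) * Real.sqrt (nsq Q (cmpAt S hk i g')) := by
    intro μ i
    exact pairing_DG (P := Q) hk1 hkr ha hm' hδ0 hδ4 hδγ μ _ _ _
      (sep_transport S hk (u := fun x => h ⟨x, μ⟩ ≠ 0) (v := fun x' => g' x' ≠ 0) (fun x x' hx hx' => hsep ⟨x, μ⟩ x' hx hx') _ _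
        (fun z hz h0 => hz (by rw [cmpAt_apply, h0]; rfl)) (fun z hz h0 => hz (by rw [cmpAt_apply, h0]; rfl)))
  have hinner : ∀ μ : Fin P.d, |∑ i : Fin N, (cmpAt S hk i (fun x => h ⟨x, μ⟩) ⬝ᵥ
      ((deriv Q 0 ((P.L : ℝ) ^ k)⁻¹ μ * Grs Q a (msq * P.mesh k ^ 2) k) *ᵥ cmpAt S hk i g'))|
        ≤ 12 / γ' * E * Real.sqrt (∑ i : Fin N, nsq Q (cmpAt S hk i (fun x => h ⟨x, μ⟩))) *
          Real.sqrt (∑ i : Fin N, nsq Q (cmpAt S hk i g')) :=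
    fun μ => abs_sum_le_of_terms _ _ _ hB0 (fun _ => nsq_nonneg _) (fun _ => nsq_nonneg _) (hterm μ)
  have houter := abs_sum_le_of_terms _ _ _ hB0 (fun μ => Finset.sum_nonneg fun i _ => nsq_nonneg _)
    (fun μ => Finset.sum_nonneg fun i _ => nsq_nonneg _) hinner
  have hA : ∑ μ : Fin P.d, ∑ i : Fin N, nsq Q (cmpAt S hk i (fun x => h ⟨x, μ⟩)) = (P.mesh 0 ^ P.d)⁻¹ * bondInner h h :=
    sum_sq_cmpAt_bond_eq S hk h
  have hB : ∑ _μ : Fin P.d, ∑ i : Fin N, nsq Q (cmpAt S hk i g') = (P.mesh 0 ^ P.d)⁻¹ * (P.d * siteInner g' g') := by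
    rw [Finset.sum_const, Finset.card_univ, Fintype.card_fin, nsmul_eq_mul,
      show ∑ i : Fin N, nsq Q (cmpAt S hk i g') = (P.mesh 0 ^ P.d)⁻¹ * siteInner g' g' from sum_sq_cmpAt_eq S hk g']
    ring
  rw [hA, hB, mul_assoc (12 / γ' * E), sqrt_scale hε, Real.sqrt_mul (Nat.cast_nonneg _)] at houter
  -- the pairing through the components
  have hid : bondInner h (covDeriv C (0 : HiggsLattice.VecField P 0)
        (propagatorK C Finset.univ (0 : HiggsLattice.VecField P 0) msq a k g'))
      = P.mesh 0 ^ P.d * (P.mesh k * ∑ μ : Fin P.d, ∑ i : Fin N, (cmpAt S hk i (fun x => h ⟨x, μ⟩) ⬝ᵥ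
          ((deriv Q 0 ((P.L : ℝ) ^ k)⁻¹ μ * Grs Q a (msq * P.mesh k ^ 2) k) *ᵥ cmpAt S hk i g'))) := by
    rw [bondInner_eq_sum_dot S hk]
    congr 1
    rw [Finset.mul_sum]
    refine Finset.sum_congr rfl fun μ _ => ?_
    rw [Finset.mul_sum]
    refine Finset.sum_congr rfl fun i _ => ?_
    rw [cmpAt_covDeriv_propagatorK S hk C hk1 ha hmsq g' μ i, dotProduct_smul, smul_eq_mul]
  rw [hid, abs_mul, abs_of_pos hε, abs_mul, abs_of_pos hℓ]
  have hε' : P.mesh 0 ^ P.d * (P.mesh 0 ^ P.d)⁻¹ = 1 := mul_inv_cancel₀ hε.ne'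
  calc P.mesh 0 ^ P.d * (P.mesh k * |∑ μ : Fin P.d, ∑ i : Fin N, (cmpAt S hk i (fun x => h ⟨x, μ⟩) ⬝ᵥ
          ((deriv Q 0 ((P.L : ℝ) ^ k)⁻¹ μ * Grs Q a (msq * P.mesh k ^ 2) k) *ᵥ cmpAt S hk i g'))|)
      ≤ P.mesh 0 ^ P.d * (P.mesh k * (12 / γ' * E *
          ((P.mesh 0 ^ P.d)⁻¹ * (Real.sqrt (bondInner h h) * (Real.sqrt P.d * Real.sqrt (siteInner g' g')))))) := by gcongr
    _ = (P.mesh 0 ^ P.d * (P.mesh 0 ^ P.d)⁻¹) *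
          (12 / γ' * Real.sqrt P.d * P.mesh k * E * Real.sqrt (bondInner h h) * Real.sqrt (siteInner g' g')) := by ring
    _ = _ := by rw [hε', one_mul]

/-- **(2.30), THIRD PAIRING `⟨g, G^ε_kD^{ε*}_0h′⟩`, FOR THE MODEL AT `A = 0`**: a site field `g` and a bond field `h′` with supports `≧ R`
apart, `D^{ε*}_0h′` the explicit adjoint derivative (`siteInner_adjDeriv`):
`|⟨g, G^ε_k(T_ε,0)D^{ε*}_0h′⟩| ≦ (8√d/γ′)(L^kε)e^{−δR/L^k}‖g‖‖h′‖`. [cite: Balaban1983RegularityDecay, Cor. 2.3 (2.30) p.580; Balaban1982Higgs1,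
(1.7)–(1.8) p.605, (2.20) p.610] -/
theorem model_pairing_GDt (S : Shape P) (hk : k ≤ P.K) (C : ChargeData N) (hk1 : 1 ≤ k) (ha : 0 < a) (hmsq : 0 ≤ msq) (hδ0 : 0 ≤ δ)
    (hδ4 : 4 * δ ≤ 1) (hδγ : (2 * P.d + 4 * a) * δ ^ 2 ≤ min 1 (a * (1 - ((P.L : ℝ) ^ 2)⁻¹)) / 4) (R : ℝ)
    (g : HiggsLattice.ScalarField P 0 N) (h' : HiggsLattice.PBond P 0 → EuclideanSpace ℝ (Fin N))
    (hsep : ∀ x b', g x ≠ 0 → h' b' ≠ 0 → R ≤ (HiggsLattice.Site.tdist x b'.src : ℝ)) :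
    |siteInner g (propagatorK C Finset.univ (0 : HiggsLattice.VecField P 0) msq a k
        (fun x => (P.mesh 0)⁻¹ • ∑ ν : Fin P.d, (h' ⟨x.unshift ν, ν⟩ - h' ⟨x, ν⟩)))|
      ≤ 8 / min 1 (a * (1 - ((P.L : ℝ) ^ 2)⁻¹)) * Real.sqrt P.d * P.mesh k * Real.exp (-(δ * (R / (P.L : ℝ) ^ k))) *
          Real.sqrt (siteInner g g) * Real.sqrt (bondInner h' h') := by
  set Q := setupAt S k with hQ
  set γ' := min 1 (a * (1 - ((P.L : ℝ) ^ 2)⁻¹)) with hγ'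
  set E := Real.exp (-(δ * (R / (P.L : ℝ) ^ k))) with hE
  have hγ : 0 < γ' := B4Cor23ZeroTorusSolve.gammaPrime_pos (P := Q) ha
  have hm' : 0 ≤ msq * P.mesh k ^ 2 := mul_nonneg hmsq (sq_nonneg _)
  have hε : 0 < P.mesh 0 ^ P.d := pow_pos (P.mesh_pos 0) _
  have hℓ : 0 < P.mesh k := P.mesh_pos k
  have hkr : k ≤ Q.m + Q.K := le_range_at S k le_rfl
  have hB0 : 0 ≤ 8 / γ' * E := by positivity
  have hterm : ∀ (i : Fin N) (ν : Fin P.d), |cmpAt S hk i g ⬝ᵥ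
      ((Grs Q a (msq * P.mesh k ^ 2) k * (deriv Q 0 ((P.L : ℝ) ^ k)⁻¹ ν)ᵀ) *ᵥ cmpAt S hk i (fun x => h' ⟨x, ν⟩))|
        ≤ 8 / γ' * E * Real.sqrt (nsq Q (cmpAt S hk i g)) * Real.sqrt (nsq Q (cmpAt S hk i (fun x => h' ⟨x, ν⟩))) := by
    intro i ν
    exact pairing_GDt (P := Q) hk1 hkr ha hm' hδ0 hδ4 hδγ ν _ _ _
      (sep_transport S hk (u := fun x => g x ≠ 0) (v := fun x' => h' ⟨x', ν⟩ ≠ 0) (fun x x' hx hx' => hsep x ⟨x', ν⟩ hx hx') _ _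
        (fun z hz h0 => hz (by rw [cmpAt_apply, h0]; rfl)) (fun z hz h0 => hz (by rw [cmpAt_apply, h0]; rfl)))
  have hinner : ∀ i : Fin N, |∑ ν : Fin P.d, (cmpAt S hk i g ⬝ᵥ
      ((Grs Q a (msq * P.mesh k ^ 2) k * (deriv Q 0 ((P.L : ℝ) ^ k)⁻¹ ν)ᵀ) *ᵥ cmpAt S hk i (fun x => h' ⟨x, ν⟩)))|
        ≤ 8 / γ' * E * Real.sqrt (∑ _ν : Fin P.d, nsq Q (cmpAt S hk i g)) *
          Real.sqrt (∑ ν : Fin P.d, nsq Q (cmpAt S hk i (fun x => h' ⟨x, ν⟩))) :=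
    fun i => abs_sum_le_of_terms _ _ _ hB0 (fun _ => nsq_nonneg _) (fun _ => nsq_nonneg _) (hterm i)
  have houter := abs_sum_le_of_terms _ _ _ hB0 (fun i => Finset.sum_nonneg fun ν _ => nsq_nonneg _)
    (fun i => Finset.sum_nonneg fun ν _ => nsq_nonneg _) hinner
  have hA : ∑ i : Fin N, ∑ _ν : Fin P.d, nsq Q (cmpAt S hk i g) = (P.mesh 0 ^ P.d)⁻¹ * (P.d * siteInner g g) := by
    simp_rw [Finset.sum_const, Finset.card_univ, Fintype.card_fin, nsmul_eq_mul]
    rw [← Finset.mul_sum, show ∑ i : Fin N, nsq Q (cmpAt S hk i g) = (P.mesh 0 ^ P.d)⁻¹ * siteInner g g from sum_sq_cmpAt_eq S hk g]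
    ring
  have hB : ∑ i : Fin N, ∑ ν : Fin P.d, nsq Q (cmpAt S hk i (fun x => h' ⟨x, ν⟩)) = (P.mesh 0 ^ P.d)⁻¹ * bondInner h' h' := by
    rw [Finset.sum_comm]; exact sum_sq_cmpAt_bond_eq S hk h'
  rw [hA, hB, mul_assoc (8 / γ' * E), sqrt_scale hε, Real.sqrt_mul (Nat.cast_nonneg _)] at houter
  have hid : siteInner g (propagatorK C Finset.univ (0 : HiggsLattice.VecField P 0) msq a k
        (fun x => (P.mesh 0)⁻¹ • ∑ ν : Fin P.d, (h' ⟨x.unshift ν, ν⟩ - h' ⟨x, ν⟩)))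
      = P.mesh 0 ^ P.d * (P.mesh k * ∑ i : Fin N, ∑ ν : Fin P.d, (cmpAt S hk i g ⬝ᵥ
          ((Grs Q a (msq * P.mesh k ^ 2) k * (deriv Q 0 ((P.L : ℝ) ^ k)⁻¹ ν)ᵀ) *ᵥ cmpAt S hk i (fun x => h' ⟨x, ν⟩)))) := by
    rw [siteInner_eq_sum_dot S hk]
    congr 1
    rw [Finset.mul_sum]
    refine Finset.sum_congr rfl fun i _ => ?_
    rw [cmpAt_propagatorK_adjDeriv S hk C hk1 ha hmsq h' i, dotProduct_smul, smul_eq_mul, dotProduct_sum]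
  rw [hid, abs_mul, abs_of_pos hε, abs_mul, abs_of_pos hℓ]
  have hε' : P.mesh 0 ^ P.d * (P.mesh 0 ^ P.d)⁻¹ = 1 := mul_inv_cancel₀ hε.ne'
  calc P.mesh 0 ^ P.d * (P.mesh k * |∑ i : Fin N, ∑ ν : Fin P.d, (cmpAt S hk i g ⬝ᵥ
          ((Grs Q a (msq * P.mesh k ^ 2) k * (deriv Q 0 ((P.L : ℝ) ^ k)⁻¹ ν)ᵀ) *ᵥ cmpAt S hk i (fun x => h' ⟨x, ν⟩)))|)
      ≤ P.mesh 0 ^ P.d * (P.mesh k * (8 / γ' * E *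
          ((P.mesh 0 ^ P.d)⁻¹ * ((Real.sqrt P.d * Real.sqrt (siteInner g g)) * Real.sqrt (bondInner h' h'))))) := by gcongr
    _ = (P.mesh 0 ^ P.d * (P.mesh 0 ^ P.d)⁻¹) *
          (8 / γ' * Real.sqrt P.d * P.mesh k * E * Real.sqrt (siteInner g g) * Real.sqrt (bondInner h' h')) := by ring
    _ = _ := by rw [hε', one_mul]

/-- **(2.30), FOURTH PAIRING `⟨h, D^ε_0G^ε_kD^{ε*}_0h′⟩`, FOR THE MODEL AT `A = 0`** — the zeroth-order, `L²`-bounded quantity (no power of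
`L^kε`): bond fields `h, h′` with supports `≧ R` apart (initial points, distance (1.3)):
`|⟨h, D^ε_0G^ε_k(T_ε,0)D^{ε*}_0h′⟩| ≦ (24d/γ′)e^{−δR/L^k}‖h‖‖h′‖`. [cite: Balaban1983RegularityDecay, Cor. 2.3 (2.30) p.580; Balaban1982Higgs1,
(1.7)–(1.8) p.605, (2.20) p.610] -/
theorem model_pairing_DGDt (S : Shape P) (hk : k ≤ P.K) (C : ChargeData N) (hk1 : 1 ≤ k) (ha : 0 < a) (hmsq : 0 ≤ msq) (hδ0 : 0 ≤ δ)
    (hδ4 : 4 * δ ≤ 1) (hδγ : (2 * P.d + 4 * a) * δ ^ 2 ≤ min 1 (a * (1 - ((P.L : ℝ) ^ 2)⁻¹)) / 4) (R : ℝ)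
    (h h' : HiggsLattice.PBond P 0 → EuclideanSpace ℝ (Fin N))
    (hsep : ∀ b b', h b ≠ 0 → h' b' ≠ 0 → R ≤ (HiggsLattice.Site.tdist b.src b'.src : ℝ)) :
    |bondInner h (covDeriv C (0 : HiggsLattice.VecField P 0) (propagatorK C Finset.univ (0 : HiggsLattice.VecField P 0) msq a k
        (fun x => (P.mesh 0)⁻¹ • ∑ ν : Fin P.d, (h' ⟨x.unshift ν, ν⟩ - h' ⟨x, ν⟩))))|
      ≤ 24 / min 1 (a * (1 - ((P.L : ℝ) ^ 2)⁻¹)) * P.d * Real.exp (-(δ * (R / (P.L : ℝ) ^ k))) *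
          Real.sqrt (bondInner h h) * Real.sqrt (bondInner h' h') := by
  set Q := setupAt S k with hQ
  set γ' := min 1 (a * (1 - ((P.L : ℝ) ^ 2)⁻¹)) with hγ'
  set E := Real.exp (-(δ * (R / (P.L : ℝ) ^ k))) with hE
  have hγ : 0 < γ' := B4Cor23ZeroTorusSolve.gammaPrime_pos (P := Q) ha
  have hm' : 0 ≤ msq * P.mesh k ^ 2 := mul_nonneg hmsq (sq_nonneg _)
  have hε : 0 < P.mesh 0 ^ P.d := pow_pos (P.mesh_pos 0) _
  have hkr : k ≤ Q.m + Q.K := le_range_at S k le_rfl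
  have hB0 : 0 ≤ 24 / γ' * E := by positivity
  have hd0 : (0 : ℝ) ≤ P.d := Nat.cast_nonneg _
  have hterm : ∀ (μ : Fin P.d) (i : Fin N) (ν : Fin P.d), |cmpAt S hk i (fun x => h ⟨x, μ⟩) ⬝ᵥ
      ((deriv Q 0 ((P.L : ℝ) ^ k)⁻¹ μ * Grs Q a (msq * P.mesh k ^ 2) k * (deriv Q 0 ((P.L : ℝ) ^ k)⁻¹ ν)ᵀ) *ᵥ
        cmpAt S hk i (fun x => h' ⟨x, ν⟩))|
        ≤ 24 / γ' * E * Real.sqrt (nsq Q (cmpAt S hk i (fun x => h ⟨x, μ⟩))) *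
          Real.sqrt (nsq Q (cmpAt S hk i (fun x => h' ⟨x, ν⟩))) := by
    intro μ i ν
    exact pairing_DGDt (P := Q) hk1 hkr ha hm' hδ0 hδ4 hδγ μ ν _ _ _
      (sep_transport S hk (u := fun x => h ⟨x, μ⟩ ≠ 0) (v := fun x' => h' ⟨x', ν⟩ ≠ 0)
        (fun x x' hx hx' => hsep ⟨x, μ⟩ ⟨x', ν⟩ hx hx') _ _
        (fun z hz h0 => hz (by rw [cmpAt_apply, h0]; rfl)) (fun z hz h0 => hz (by rw [cmpAt_apply, h0]; rfl)))
  -- three Cauchy–Schwarz levels: ν, then i, then μ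
  have hν : ∀ (μ : Fin P.d) (i : Fin N), |∑ ν : Fin P.d, (cmpAt S hk i (fun x => h ⟨x, μ⟩) ⬝ᵥ
      ((deriv Q 0 ((P.L : ℝ) ^ k)⁻¹ μ * Grs Q a (msq * P.mesh k ^ 2) k * (deriv Q 0 ((P.L : ℝ) ^ k)⁻¹ ν)ᵀ) *ᵥ
        cmpAt S hk i (fun x => h' ⟨x, ν⟩)))|
        ≤ 24 / γ' * E * Real.sqrt (∑ _ν : Fin P.d, nsq Q (cmpAt S hk i (fun x => h ⟨x, μ⟩))) *
          Real.sqrt (∑ ν : Fin P.d, nsq Q (cmpAt S hk i (fun x => h' ⟨x, ν⟩))) :=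
    fun μ i => abs_sum_le_of_terms _ _ _ hB0 (fun _ => nsq_nonneg _) (fun _ => nsq_nonneg _) (hterm μ i)
  have hi : ∀ μ : Fin P.d, |∑ i : Fin N, ∑ ν : Fin P.d, (cmpAt S hk i (fun x => h ⟨x, μ⟩) ⬝ᵥ
      ((deriv Q 0 ((P.L : ℝ) ^ k)⁻¹ μ * Grs Q a (msq * P.mesh k ^ 2) k * (deriv Q 0 ((P.L : ℝ) ^ k)⁻¹ ν)ᵀ) *ᵥ
        cmpAt S hk i (fun x => h' ⟨x, ν⟩)))|
        ≤ 24 / γ' * E * Real.sqrt (∑ i : Fin N, ∑ _ν : Fin P.d, nsq Q (cmpAt S hk i (fun x => h ⟨x, μ⟩))) *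
          Real.sqrt (∑ i : Fin N, ∑ ν : Fin P.d, nsq Q (cmpAt S hk i (fun x => h' ⟨x, ν⟩))) :=
    fun μ => abs_sum_le_of_terms _ _ _ hB0 (fun i => Finset.sum_nonneg fun _ _ => nsq_nonneg _)
      (fun i => Finset.sum_nonneg fun _ _ => nsq_nonneg _) (hν μ)
  have houter := abs_sum_le_of_terms _ _ _ hB0 (fun μ => Finset.sum_nonneg fun i _ => Finset.sum_nonneg fun _ _ => nsq_nonneg _)
    (fun μ => Finset.sum_nonneg fun i _ => Finset.sum_nonneg fun _ _ => nsq_nonneg _) hi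
  have hA : ∑ μ : Fin P.d, ∑ i : Fin N, ∑ _ν : Fin P.d, nsq Q (cmpAt S hk i (fun x => h ⟨x, μ⟩))
      = (P.mesh 0 ^ P.d)⁻¹ * (P.d * bondInner h h) := by
    simp_rw [Finset.sum_const, Finset.card_univ, Fintype.card_fin, nsmul_eq_mul]
    simp_rw [← Finset.mul_sum]
    rw [sum_sq_cmpAt_bond_eq S hk h]
    ring
  have hB : ∑ _μ : Fin P.d, ∑ i : Fin N, ∑ ν : Fin P.d, nsq Q (cmpAt S hk i (fun x => h' ⟨x, ν⟩))
      = (P.mesh 0 ^ P.d)⁻¹ * (P.d * bondInner h' h') := by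
    rw [Finset.sum_const, Finset.card_univ, Fintype.card_fin, nsmul_eq_mul, Finset.sum_comm, sum_sq_cmpAt_bond_eq S hk h']
    ring
  rw [hA, hB, mul_assoc (24 / γ' * E), sqrt_scale hε, Real.sqrt_mul hd0, Real.sqrt_mul hd0] at houter
  have hid : bondInner h (covDeriv C (0 : HiggsLattice.VecField P 0) (propagatorK C Finset.univ (0 : HiggsLattice.VecField P 0) msq a k
        (fun x => (P.mesh 0)⁻¹ • ∑ ν : Fin P.d, (h' ⟨x.unshift ν, ν⟩ - h' ⟨x, ν⟩))))
      = P.mesh 0 ^ P.d * ∑ μ : Fin P.d, ∑ i : Fin N, ∑ ν : Fin P.d, (cmpAt S hk i (fun x => h ⟨x, μ⟩) ⬝ᵥ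
          ((deriv Q 0 ((P.L : ℝ) ^ k)⁻¹ μ * Grs Q a (msq * P.mesh k ^ 2) k * (deriv Q 0 ((P.L : ℝ) ^ k)⁻¹ ν)ᵀ) *ᵥ
            cmpAt S hk i (fun x => h' ⟨x, ν⟩))) := by
    rw [bondInner_eq_sum_dot S hk]
    congr 1
    refine Finset.sum_congr rfl fun μ _ => Finset.sum_congr rfl fun i _ => ?_
    rw [cmpAt_covDeriv_propagatorK_adjDeriv S hk C hk1 ha hmsq h' μ i, dotProduct_sum]
  rw [hid, abs_mul, abs_of_pos hε]
  have hε' : P.mesh 0 ^ P.d * (P.mesh 0 ^ P.d)⁻¹ = 1 := mul_inv_cancel₀ hε.ne'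
  have hdd : Real.sqrt P.d * Real.sqrt P.d = P.d := Real.mul_self_sqrt hd0
  calc P.mesh 0 ^ P.d * |∑ μ : Fin P.d, ∑ i : Fin N, ∑ ν : Fin P.d, (cmpAt S hk i (fun x => h ⟨x, μ⟩) ⬝ᵥ
          ((deriv Q 0 ((P.L : ℝ) ^ k)⁻¹ μ * Grs Q a (msq * P.mesh k ^ 2) k * (deriv Q 0 ((P.L : ℝ) ^ k)⁻¹ ν)ᵀ) *ᵥ
            cmpAt S hk i (fun x => h' ⟨x, ν⟩)))|
      ≤ P.mesh 0 ^ P.d * (24 / γ' * E * ((P.mesh 0 ^ P.d)⁻¹ *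
          ((Real.sqrt P.d * Real.sqrt (bondInner h h)) * (Real.sqrt P.d * Real.sqrt (bondInner h' h'))))) := by gcongr
    _ = (P.mesh 0 ^ P.d * (P.mesh 0 ^ P.d)⁻¹) * (Real.sqrt P.d * Real.sqrt P.d) *
          (24 / γ' * E * Real.sqrt (bondInner h h) * Real.sqrt (bondInner h' h')) := by ring
    _ = _ := by rw [hε', one_mul, hdd]; ring

end Pairings

/-! ## §2 Uniform packaging: one `δ₀`, `c₀` for the whole sub-family -/

/-- the admissible exponent: `δ₀ = min{¼, γ′/(8d + 16a + 4)}` satisfies `0 < δ₀`, `4δ₀ ≦ 1`, `(2d + 4a)δ₀² ≦ γ′/4`. [cite: Balaban1983RegularityDecay,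
Cor. 2.3 p.580 («there exist positive constants c₀, δ₀»)] -/
theorem exists_admissible_delta (d : ℕ) {γ' a : ℝ} (hγ : 0 < γ') (ha : 0 < a) :
    ∃ δ₀ : ℝ, 0 < δ₀ ∧ 4 * δ₀ ≤ 1 ∧ (2 * (d : ℝ) + 4 * a) * δ₀ ^ 2 ≤ γ' / 4 := by
  have hden : (0 : ℝ) < 8 * d + 16 * a + 4 := by positivity
  refine ⟨min (1 / 4 : ℝ) (γ' / (8 * d + 16 * a + 4)), lt_min (by norm_num) (div_pos hγ hden), ?_, ?_⟩
  · have := min_le_left (1 / 4 : ℝ) (γ' / (8 * d + 16 * a + 4)); linarith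
  · set δ₀ := min (1 / 4 : ℝ) (γ' / (8 * d + 16 * a + 4)) with hδ₀
    have h0 : 0 ≤ δ₀ := (lt_min (by norm_num) (div_pos hγ hden)).le
    have h1 : δ₀ ≤ 1 / 4 := min_le_left _ _
    have h2 : δ₀ ≤ γ' / (8 * d + 16 * a + 4) := min_le_right _ _
    have h3 : δ₀ ^ 2 ≤ 1 / 4 * (γ' / (8 * d + 16 * a + 4)) := by
      rw [sq]; exact mul_le_mul h1 h2 h0 (by norm_num)
    have hd0 : (0 : ℝ) ≤ 2 * d + 4 * a := by positivity
    calc (2 * (d : ℝ) + 4 * a) * δ₀ ^ 2 ≤ (2 * (d : ℝ) + 4 * a) * (1 / 4 * (γ' / (8 * d + 16 * a + 4))) :=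
          mul_le_mul_of_nonneg_left h3 hd0
      _ = γ' / 4 * ((2 * d + 4 * a) / (8 * d + 16 * a + 4)) := by ring
      _ ≤ γ' / 4 * 1 := by
          refine mul_le_mul_of_nonneg_left ?_ (by positivity)
          rw [div_le_one hden]; linarith
      _ = γ' / 4 := mul_one _

/-- **[B4] COROLLARY 2.3 (2.30), ALL FOUR PAIRINGS, FOR THE (Higgs)₂,₃ MODEL'S `G^ε_k(T_ε, 0)` — UNIFORM ON THE SUB-FAMILY.**  For `L > 1`, `a > 0`
and any `d` there are `δ₀, c₀ > 0` (functions of `d, L, a` only) such that on EVERY torus `T_ε` of the sub-family `M·L′_μ = L^m` with `P.d = d`,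
`P.L = L`, for every `N`, every coupling `C`, every `m² ≧ 0`, every level `1 ≦ k ≦ K` and all test functions whose supports are `≧ R` apart
in (1.3) (sites / initial points of bonds):  `|⟨g, G^ε_kg′⟩| ≦ c₀(L^kε)²e^{−δ₀R/L^k}‖g‖‖g′‖`, `|⟨h, D^ε_0G^ε_kg′⟩| ≦ c₀(L^kε)e^{−δ₀R/L^k}‖h‖‖g′‖`,
`|⟨g, G^ε_kD^{ε*}_0h′⟩| ≦ c₀(L^kε)e^{−δ₀R/L^k}‖g‖‖h′‖`, `|⟨h, D^ε_0G^ε_kD^{ε*}_0h′⟩| ≦ c₀e^{−δ₀R/L^k}‖h‖‖h′‖` — the powers of `L^kε` being those of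
(2.25) after rescaling (2.22), and `R/L^k = (L^kε)^{−1}·εR` the printed `(L^kε)^{−1}dist`.  No mass cap, no smallness condition, no
restriction on the supports. [cite: Balaban1983RegularityDecay, Cor. 2.3 (2.30) pp.580–581; Balaban1982Higgs1, Prop. 2.1 (2.25) p.610] -/
theorem cor23_model_zeroField_torus (d L : ℕ) (hL : 1 < L) {a : ℝ} (ha : 0 < a) :
    ∃ δ₀ c₀ : ℝ, 0 < δ₀ ∧ 0 < c₀ ∧ ∀ (P : HiggsLattice.Params) (_S : Shape P), P.d = d → P.L = L →
      ∀ {N : ℕ} (C : ChargeData N) (msq : ℝ), 0 ≤ msq → ∀ {k : ℕ}, 1 ≤ k → k ≤ P.K →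
        ∀ (R : ℝ) (g g' : HiggsLattice.ScalarField P 0 N) (h h' : HiggsLattice.PBond P 0 → EuclideanSpace ℝ (Fin N)),
          ((∀ x x', g x ≠ 0 → g' x' ≠ 0 → R ≤ (HiggsLattice.Site.tdist x x' : ℝ)) →
            |siteInner g (propagatorK C Finset.univ (0 : HiggsLattice.VecField P 0) msq a k g')|
              ≤ c₀ * P.mesh k ^ 2 * Real.exp (-(δ₀ * (R / (P.L : ℝ) ^ k))) * Real.sqrt (siteInner g g) * Real.sqrt (siteInner g' g')) ∧
          ((∀ b x', h b ≠ 0 → g' x' ≠ 0 → R ≤ (HiggsLattice.Site.tdist b.src x' : ℝ)) →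
            |bondInner h (covDeriv C (0 : HiggsLattice.VecField P 0)
                (propagatorK C Finset.univ (0 : HiggsLattice.VecField P 0) msq a k g'))|
              ≤ c₀ * P.mesh k * Real.exp (-(δ₀ * (R / (P.L : ℝ) ^ k))) * Real.sqrt (bondInner h h) * Real.sqrt (siteInner g' g')) ∧
          ((∀ x b', g x ≠ 0 → h' b' ≠ 0 → R ≤ (HiggsLattice.Site.tdist x b'.src : ℝ)) →
            |siteInner g (propagatorK C Finset.univ (0 : HiggsLattice.VecField P 0) msq a k
                (fun x => (P.mesh 0)⁻¹ • ∑ ν : Fin P.d, (h' ⟨x.unshift ν, ν⟩ - h' ⟨x, ν⟩)))|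
              ≤ c₀ * P.mesh k * Real.exp (-(δ₀ * (R / (P.L : ℝ) ^ k))) * Real.sqrt (siteInner g g) * Real.sqrt (bondInner h' h')) ∧
          ((∀ b b', h b ≠ 0 → h' b' ≠ 0 → R ≤ (HiggsLattice.Site.tdist b.src b'.src : ℝ)) →
            |bondInner h (covDeriv C (0 : HiggsLattice.VecField P 0)
                (propagatorK C Finset.univ (0 : HiggsLattice.VecField P 0) msq a k
                  (fun x => (P.mesh 0)⁻¹ • ∑ ν : Fin P.d, (h' ⟨x.unshift ν, ν⟩ - h' ⟨x, ν⟩))))|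
              ≤ c₀ * Real.exp (-(δ₀ * (R / (P.L : ℝ) ^ k))) * Real.sqrt (bondInner h h) * Real.sqrt (bondInner h' h')) := by
  set γ' := min 1 (a * (1 - ((L : ℝ) ^ 2)⁻¹)) with hγ'
  have hL1 : (1 : ℝ) < L := by exact_mod_cast hL
  have hγ : 0 < γ' := by
    have hL2 : (1 : ℝ) < (L : ℝ) ^ 2 := by nlinarith
    have hinv : ((L : ℝ) ^ 2)⁻¹ < 1 := inv_lt_one_of_one_lt₀ hL2
    exact lt_min one_pos (mul_pos ha (by linarith))
  obtain ⟨δ₀, hδ₀pos, hδ₀4, hδ₀γ⟩ := exists_admissible_delta d hγ ha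
  have hd1 : Real.sqrt d ≤ (d : ℝ) + 1 := by
    rcases Nat.eq_zero_or_pos d with h0 | hpos
    · subst h0; simp
    · have h1 : (1 : ℝ) ≤ d := by exact_mod_cast hpos
      calc Real.sqrt d ≤ Real.sqrt (d * d) := Real.sqrt_le_sqrt (by nlinarith)
        _ = d := Real.sqrt_mul_self (by positivity)
        _ ≤ d + 1 := by linarith
  refine ⟨δ₀, 24 * ((d : ℝ) + 1) / γ', hδ₀pos, by positivity, ?_⟩
  intro P S hPd hPL N C msq hmsq k hk1 hk R g g' h h'
  subst hPd hPL
  have hδγ : (2 * (P.d : ℝ) + 4 * a) * δ₀ ^ 2 ≤ min 1 (a * (1 - ((P.L : ℝ) ^ 2)⁻¹)) / 4 := hδ₀γ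
  have hE0 : 0 ≤ Real.exp (-(δ₀ * (R / (P.L : ℝ) ^ k))) := Real.exp_nonneg _
  have hℓ : 0 ≤ P.mesh k := (P.mesh_pos k).le
  -- the four constants are below `24(d+1)/γ′`
  have hc1 : 4 / γ' ≤ 24 * ((P.d : ℝ) + 1) / γ' := div_le_div_of_nonneg_right (by nlinarith [Nat.cast_nonneg (α := ℝ) P.d]) hγ.le
  have hc2 : 12 / γ' * Real.sqrt P.d ≤ 24 * ((P.d : ℝ) + 1) / γ' := by
    rw [div_mul_eq_mul_div]; exact div_le_div_of_nonneg_right (by nlinarith [Real.sqrt_nonneg (P.d : ℝ)]) hγ.le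
  have hc3 : 8 / γ' * Real.sqrt P.d ≤ 24 * ((P.d : ℝ) + 1) / γ' := by
    rw [div_mul_eq_mul_div]; exact div_le_div_of_nonneg_right (by nlinarith [Real.sqrt_nonneg (P.d : ℝ)]) hγ.le
  have hc4 : 24 / γ' * P.d ≤ 24 * ((P.d : ℝ) + 1) / γ' := by
    rw [div_mul_eq_mul_div]; exact div_le_div_of_nonneg_right (by nlinarith [Nat.cast_nonneg (α := ℝ) P.d]) hγ.le
  refine ⟨fun hsep => ?_, fun hsep => ?_, fun hsep => ?_, fun hsep => ?_⟩
  · refine (model_pairing_G S hk C hk1 ha hmsq hδ₀pos.le hδ₀4 hδγ R g g' hsep).trans ?_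
    have hr : 0 ≤ P.mesh k ^ 2 * Real.exp (-(δ₀ * (R / (P.L : ℝ) ^ k))) * Real.sqrt (siteInner g g) * Real.sqrt (siteInner g' g') := by
      positivity
    calc 4 / γ' * P.mesh k ^ 2 * Real.exp (-(δ₀ * (R / (P.L : ℝ) ^ k))) * Real.sqrt (siteInner g g) * Real.sqrt (siteInner g' g')
        = 4 / γ' * (P.mesh k ^ 2 * Real.exp (-(δ₀ * (R / (P.L : ℝ) ^ k))) * Real.sqrt (siteInner g g) * Real.sqrt (siteInner g' g')) := by
          ring
      _ ≤ 24 * ((P.d : ℝ) + 1) / γ' *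
          (P.mesh k ^ 2 * Real.exp (-(δ₀ * (R / (P.L : ℝ) ^ k))) * Real.sqrt (siteInner g g) * Real.sqrt (siteInner g' g')) :=
          mul_le_mul_of_nonneg_right hc1 hr
      _ = _ := by ring
  · refine (model_pairing_DG S hk C hk1 ha hmsq hδ₀pos.le hδ₀4 hδγ R h g' hsep).trans ?_
    have hr : 0 ≤ P.mesh k * Real.exp (-(δ₀ * (R / (P.L : ℝ) ^ k))) * Real.sqrt (bondInner h h) * Real.sqrt (siteInner g' g') := by
      positivity
    calc 12 / γ' * Real.sqrt P.d * P.mesh k * Real.exp (-(δ₀ * (R / (P.L : ℝ) ^ k))) * Real.sqrt (bondInner h h) *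
          Real.sqrt (siteInner g' g')
        = 12 / γ' * Real.sqrt P.d *
            (P.mesh k * Real.exp (-(δ₀ * (R / (P.L : ℝ) ^ k))) * Real.sqrt (bondInner h h) * Real.sqrt (siteInner g' g')) := by ring
      _ ≤ 24 * ((P.d : ℝ) + 1) / γ' *
            (P.mesh k * Real.exp (-(δ₀ * (R / (P.L : ℝ) ^ k))) * Real.sqrt (bondInner h h) * Real.sqrt (siteInner g' g')) :=
          mul_le_mul_of_nonneg_right hc2 hr
      _ = _ := by ring
  · refine (model_pairing_GDt S hk C hk1 ha hmsq hδ₀pos.le hδ₀4 hδγ R g h' hsep).trans ?_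
    have hr : 0 ≤ P.mesh k * Real.exp (-(δ₀ * (R / (P.L : ℝ) ^ k))) * Real.sqrt (siteInner g g) * Real.sqrt (bondInner h' h') := by
      positivity
    calc 8 / γ' * Real.sqrt P.d * P.mesh k * Real.exp (-(δ₀ * (R / (P.L : ℝ) ^ k))) * Real.sqrt (siteInner g g) *
          Real.sqrt (bondInner h' h')
        = 8 / γ' * Real.sqrt P.d *
            (P.mesh k * Real.exp (-(δ₀ * (R / (P.L : ℝ) ^ k))) * Real.sqrt (siteInner g g) * Real.sqrt (bondInner h' h')) := by ring
      _ ≤ 24 * ((P.d : ℝ) + 1) / γ' *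
            (P.mesh k * Real.exp (-(δ₀ * (R / (P.L : ℝ) ^ k))) * Real.sqrt (siteInner g g) * Real.sqrt (bondInner h' h')) :=
          mul_le_mul_of_nonneg_right hc3 hr
      _ = _ := by ring
  · refine (model_pairing_DGDt S hk C hk1 ha hmsq hδ₀pos.le hδ₀4 hδγ R h h' hsep).trans ?_
    have hr : 0 ≤ Real.exp (-(δ₀ * (R / (P.L : ℝ) ^ k))) * Real.sqrt (bondInner h h) * Real.sqrt (bondInner h' h') := by
      positivity
    calc 24 / γ' * P.d * Real.exp (-(δ₀ * (R / (P.L : ℝ) ^ k))) * Real.sqrt (bondInner h h) * Real.sqrt (bondInner h' h')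
        = 24 / γ' * P.d * (Real.exp (-(δ₀ * (R / (P.L : ℝ) ^ k))) * Real.sqrt (bondInner h h) * Real.sqrt (bondInner h' h')) := by ring
      _ ≤ 24 * ((P.d : ℝ) + 1) / γ' * (Real.exp (-(δ₀ * (R / (P.L : ℝ) ^ k))) * Real.sqrt (bondInner h h) * Real.sqrt (bondInner h' h')) :=
          mul_le_mul_of_nonneg_right hc4 hr
      _ = _ := by ring

end Literature.MathematicalPhysics.QuantumFieldTheory.Balaban1983to89.B1Cor23DerivZeroFieldTorus
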